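/-
Copyright: H21 programme, solo seat `solo-RiemannHypothesis-informed` (session 5).
-/
import Summits.RiemannHypothesis.RiemannHypothesis.Theorems.SoloInformedClusterFarOffset

/-!
# Far zeros with decay of arbitrary order (solo-informed, T33–T34)

In T30–T32 (`SoloInformedClusterFarOffset`) the far zeros of the window (offset `≤ θ < ½`, height
distance `≥ Δ₀`) are bounded with decay of order `2`, so the near zone has radius `e^{θ(c+1)}`.
Using decay of order `p + 2` (T28a) instead, the far terms cost `e^{2θ(c+1)}/Δ₀^{2p+2}`, which is
`≤ 1` once `Δ₀^{p+1} ≥ e^{θ(c+1)}`: the near zone shrinks to `e^{θ(c+1)/(p+1)}`, i.e. to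
`C_p (log(|γ₀|+2))^{θ/(2η(p+1))}` at the double-log window — ANY positive power of `log γ₀` — at
the sole price of the derivative order `2N + 4 + p` in the cluster constant
(`clusterKp`, `clusterFarC0p`; `p = 0` is T30/T31).

* `exists_clusterTest_gen` — the cluster test of T25 with norms controlled up to order `p + 2`;
* `weilGroundEnergy_neg_of_farOffset_cluster_decay_eff` (**T33**, threshold form);
* `weilGroundEnergy_neg_of_farOffset_cluster_decay_window_eff` (**T34**, window form) and the
  exclusion form `riemannZeta_ne_zero_of_nearCluster_decay_of_weilGroundEnergy_nonneg_eff`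
  (**T34″**, `θ = windowMaxOffset γ₀ R`: no hypothesis on the far zeros, near zone
  `Δ₀ ≥ e^{Θ(c+1)/(p+1)}`, `≤ R^{2Θ/(p+1)}`).
-/

open MeasureTheory Complex Set Filter Topology Literature.NumberTheory.LFunctions
open scoped ContDiff

namespace Summit.RiemannHypothesis.RiemannHypothesis.Theorems

variable {ψ : ℝ → ℝ}

/-! ## The cluster test with higher norms -/

/-- **The cluster test, norms up to order `p + 2`.**  As `exists_clusterTest` with
`‖k^{(j)}‖₁ ≤ 2(1 + R₀²)^N B_{2N+4+p}(ψ)` for all `j ≤ p + 2`. -/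
theorem exists_clusterTest_gen (hψ : ContDiff ℝ ∞ ψ) (hsupp : tsupport ψ ⊆ Icc (-1) 1)
    (hψ0 : ∀ s, 0 ≤ ψ s) (N : ℕ) (R₀ : ℝ) (p : ℕ) {η γ₀ c δ : ℝ} {S' : Finset ℂ} (hη : 0 < η)
    (hc : 0 ≤ c) (hδ : 0 < δ) (hδ1 : δ ≤ 1) (hcard : S'.card ≤ N)
    (hclus : ∀ ρ ∈ S', ‖ρ - (1 / 2 + γ₀ * I)‖ ≤ R₀ ∧ δ ≤ ‖ρ - (1 / 2 + η + γ₀ * I)‖ ∧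
      δ ≤ ‖ρ - (1 / 2 - η + γ₀ * I)‖)
    (hgpos : 0 < Real.exp (η * c) * bumpLaplace ψ η - bumpLaplace ψ (-η)) :
    ∃ k : ℝ → ℂ, IsWeilTest k ∧ (∀ t, k (-t) = -k t) ∧ tsupport k ⊆ Icc (-(c + 1)) (c + 1) ∧
      0 < ∫ t, ‖k t‖ ^ 2 ∧
      (∀ j ≤ p + 2,
        ∫ t, ‖iteratedDeriv j k t‖ ≤ 2 * ((1 + R₀ ^ 2) ^ N * bumpNormSum ψ (2 * N + 4 + p))) ∧
      η ^ 4 * δ ^ (4 * N) * (Real.exp (η * c) * bumpLaplace ψ η - bumpLaplace ψ (-η)) ^ 2 ≤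
        ‖∫ t, k t * cexp ((η : ℂ) * t)‖ ^ 2 ∧
      (∀ ρ ∈ S', weilMellin (fun t ↦ k t * cexp (-(γ₀ * I) * t)) ρ = 0) := by
  set B : ℝ := bumpNormSum ψ (2 * N + 4 + p) with hB_def
  have hB0 : 0 ≤ B := bumpNormSum_nonneg ψ _
  set Q : ℝ := (1 + R₀ ^ 2) ^ N * B with hQ_def
  -- the test `k = D_0 D_{clusterList} h_c`
  set L : List ℂ := clusterList γ₀ S' with hL_def
  set w : ℝ → ℂ := weilDodges L (bumpDipole ψ c) with hw_def
  set k : ℝ → ℂ := weilDodge 0 w with hk_def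
  have hh : IsWeilTest (bumpDipole ψ c) := isWeilTest_bumpDipole hψ hsupp hc
  have hhodd : ∀ t, bumpDipole ψ c (-t) = -bumpDipole ψ c t := bumpDipole_odd ψ c
  have hhs : tsupport (bumpDipole ψ c) ⊆ Icc (-(c + 1)) (c + 1) :=
    tsupport_bumpDipole_subset hsupp hc
  have hw : IsWeilTest w := isWeilTest_weilDodges hh L
  have hwodd : ∀ t, w (-t) = -w t := weilDodges_odd hhodd L
  have hk : IsWeilTest k := isWeilTest_weilDodge hw 0
  have hkodd : ∀ t, k (-t) = -k t := weilDodge_odd hwodd 0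
  have hks : tsupport k ⊆ Icc (-(c + 1)) (c + 1) :=
    ((tsupport_weilDodge_subset 0 w).trans (tsupport_weilDodges_subset L _)).trans hhs
  have hk_eq : k = weilDodges (0 :: L) (bumpDipole ψ c) := rfl
  -- the gain of the undodged dipole
  set g : ℝ := Real.exp (η * c) * bumpLaplace ψ η - bumpLaplace ψ (-η) with hg_def
  have hg0 : 0 ≤ g := hgpos.le
  have hgain : g ≤ ‖∫ t, bumpDipole ψ c t * cexp ((η : ℂ) * t)‖ :=
    gain_bumpDipole hψ.continuous hsupp hψ0 hη.le hc
  have hint_ne : ∫ t, bumpDipole ψ c t * cexp ((η : ℂ) * t) ≠ 0 := by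
    intro h0
    rw [h0, norm_zero] at hgain
    linarith
  -- the cluster symbol at the pair
  set Pη : ℂ := ∏ ρ ∈ S', (ρ - (1 / 2 + η + γ₀ * I)) * (ρ - (1 / 2 - η + γ₀ * I)) with hPη_def
  have hPη : δ ^ (2 * S'.card) ≤ ‖Pη‖ :=
    pow_le_norm_clusterSymbol S' hδ.le fun ρ hρ ↦ ⟨(hclus ρ hρ).2.1, (hclus ρ hρ).2.2⟩
  have hPηN : δ ^ (2 * N) ≤ ‖Pη‖ := (pow_le_pow_of_le_one hδ.le hδ1 (by omega)).trans hPη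
  have hPη0 : 0 < ‖Pη‖ := lt_of_lt_of_le (by positivity) hPηN
  have e1 : ∀ f : ℝ → ℂ, ∫ t : ℝ, f t * cexp ((η : ℂ) * t) = weilMellin f (1 / 2 + η) := by
    intro f; unfold weilMellin; congr 1 with t; congr 2; ring
  have hsymb : (L.map fun τ ↦ (-((1 : ℂ) / 2 + η - 1 / 2) ^ 2 - τ ^ 2)).prod = Pη := by
    rw [hPη_def, ← clusterSymbol_eq γ₀ S' η, hL_def]
    have e : (fun τ : ℂ ↦ (-((1 : ℂ) / 2 + η - 1 / 2) ^ 2 - τ ^ 2)) =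
        fun τ ↦ (-(η : ℂ) ^ 2 - τ ^ 2) := by
      funext τ; ring
    rw [e]
  have hw_int : ∫ t, w t * cexp ((η : ℂ) * t) =
      Pη * ∫ t, bumpDipole ψ c t * cexp ((η : ℂ) * t) := by
    rw [e1, e1, hw_def, weilMellin_weilDodges hh L, hsymb]
  have hw_ne : ∫ t, w t * cexp ((η : ℂ) * t) ≠ 0 := by
    rw [hw_int]; exact mul_ne_zero (norm_pos_iff.mp hPη0) hint_ne
  have hpos : 0 < ∫ t, ‖k t‖ ^ 2 := integral_norm_sq_weilDodge_zero_pos hw hη.ne' hw_ne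
  have hnη : ‖(-((1 : ℂ) / 2 + η - 1 / 2) ^ 2 - (0 : ℂ) ^ 2)‖ = η ^ 2 := by
    have e : (-((1 : ℂ) / 2 + η - 1 / 2) ^ 2 - (0 : ℂ) ^ 2) = (((-(η ^ 2)) : ℝ) : ℂ) := by
      push_cast; ring
    rw [e, Complex.norm_real, Real.norm_eq_abs, abs_neg, abs_of_nonneg (sq_nonneg η)]
  have hk_int : ‖∫ t, k t * cexp ((η : ℂ) * t)‖ ^ 2 =
      η ^ 4 * ‖Pη‖ ^ 2 * ‖∫ t, bumpDipole ψ c t * cexp ((η : ℂ) * t)‖ ^ 2 := by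
    rw [e1 k, hk_def, weilMellin_weilDodge (contDiff_two_of_isWeilTest hw) hw.2, ← e1 w, hw_int,
      norm_mul, norm_mul, hnη]
    ring
  -- the list `0 :: L`: length and norm-inflation factor
  have hlen : (0 :: L).length = S'.card + 1 := by
    rw [List.length_cons, hL_def, length_clusterList]
  have hprod : ((0 :: L).map fun τ ↦ 1 + ‖τ‖ ^ 2).prod ≤ (1 + R₀ ^ 2) ^ N := by
    rw [List.map_cons, List.prod_cons, norm_zero, hL_def]
    unfold clusterList
    rw [List.map_map, Finset.prod_map_toList]
    have e : ∏ ρ ∈ S', ((fun τ : ℂ ↦ 1 + ‖τ‖ ^ 2) ∘ clusterShift γ₀) ρ =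
        ∏ ρ ∈ S', (1 + ‖ρ - (1 / 2 + γ₀ * I)‖ ^ 2) := by
      refine Finset.prod_congr rfl fun ρ _ ↦ ?_
      simp only [Function.comp_apply, clusterShift, norm_mul, Complex.norm_I, one_mul]
      rw [show ρ - 1 / 2 - (γ₀ : ℂ) * I = ρ - (1 / 2 + γ₀ * I) by ring]
    rw [e]
    calc ((1 : ℝ) + 0 ^ 2) * ∏ ρ ∈ S', (1 + ‖ρ - (1 / 2 + γ₀ * I)‖ ^ 2)
        = ∏ ρ ∈ S', (1 + ‖ρ - (1 / 2 + γ₀ * I)‖ ^ 2) := by ring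
      _ ≤ ∏ _ρ ∈ S', (1 + R₀ ^ 2) := by
          refine Finset.prod_le_prod (fun ρ _ ↦ by positivity) fun ρ hρ ↦ ?_
          have h1 := (hclus ρ hρ).1
          nlinarith [norm_nonneg (ρ - (1 / 2 + γ₀ * I))]
      _ = (1 + R₀ ^ 2) ^ S'.card := Finset.prod_const _
      _ ≤ (1 + R₀ ^ 2) ^ N := pow_le_pow_right₀ (by nlinarith) hcard
  -- the `c`-independent norms of `k`
  have hnorm : ∀ j ≤ p + 2, ∫ t, ‖iteratedDeriv j k t‖ ≤ 2 * Q := by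
    intro j hj
    have hjm : j + 2 * (0 :: L).length ≤ 2 * N + 4 + p := by rw [hlen]; omega
    calc ∫ t, ‖iteratedDeriv j k t‖
        = ∫ t, ‖iteratedDeriv j (weilDodges (0 :: L) (bumpDipole ψ c)) t‖ := by rw [hk_eq]
      _ ≤ ((0 :: L).map fun τ ↦ 1 + ‖τ‖ ^ 2).prod * (2 * B) :=
          integral_norm_iteratedDeriv_weilDodges_bumpDipole_le hψ hsupp hc (2 * N + 4 + p) (0 :: L)
            hjm
      _ ≤ (1 + R₀ ^ 2) ^ N * (2 * B) := mul_le_mul_of_nonneg_right hprod (by positivity)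
      _ = 2 * Q := by rw [hQ_def]; ring
  -- the gain of `k` dominates `η⁴ δ^{4N} g²`
  have hG : η ^ 4 * δ ^ (4 * N) * g ^ 2 ≤ ‖∫ t, k t * cexp ((η : ℂ) * t)‖ ^ 2 := by
    rw [hk_int]
    have hP2 : δ ^ (4 * N) ≤ ‖Pη‖ ^ 2 := by
      rw [show 4 * N = 2 * N * 2 by ring, pow_mul]
      exact pow_le_pow_left₀ (by positivity) hPηN 2
    have hG2 : g ^ 2 ≤ ‖∫ t, bumpDipole ψ c t * cexp ((η : ℂ) * t)‖ ^ 2 :=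
      pow_le_pow_left₀ hg0 hgain 2
    have hPG := mul_le_mul hP2 hG2 (sq_nonneg _) (sq_nonneg _)
    calc η ^ 4 * δ ^ (4 * N) * g ^ 2 = η ^ 4 * (δ ^ (4 * N) * g ^ 2) := by ring
      _ ≤ η ^ 4 * (‖Pη‖ ^ 2 * ‖∫ t, bumpDipole ψ c t * cexp ((η : ℂ) * t)‖ ^ 2) :=
          mul_le_mul_of_nonneg_left hPG (by positivity)
      _ = η ^ 4 * ‖Pη‖ ^ 2 * ‖∫ t, bumpDipole ψ c t * cexp ((η : ℂ) * t)‖ ^ 2 := by ring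
  -- the twisted transform of `k` vanishes on the cluster
  have hvan : ∀ ρ ∈ S', weilMellin (fun t ↦ k t * cexp (-(γ₀ * I) * t)) ρ = 0 := by
    intro ρ hρ
    rw [hk_eq, weilMellin_weilDodges_twist hh, List.map_cons, List.prod_cons]
    have h0 := weilMellin_clusterDodges_twist_eq_zero hh γ₀ S' hρ
    rw [weilMellin_weilDodges_twist hh, ← hL_def] at h0
    rw [mul_assoc, h0, mul_zero]
  exact ⟨k, hk, hkodd, hks, hpos, hnorm, hG, hvan⟩

/-! ## T33: threshold form with decay of order `p + 2` -/

/-- The cluster constant with derivative order `2N + 4 + p`: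
`K_{N,p}(ψ, R₀) = 16 A₁ ((1 + R₀²)^N B_{2N+4+p}(ψ))² + 1`. -/
noncomputable def clusterKp (ψ : ℝ → ℝ) (N : ℕ) (R₀ : ℝ) (p : ℕ) : ℝ :=
  16 * zetaDensityConst * ((1 + R₀ ^ 2) ^ N * bumpNormSum ψ (2 * N + 4 + p)) ^ 2 + 1

/-- `0 < K_{N,p}`. -/
theorem clusterKp_pos (ψ : ℝ → ℝ) (N : ℕ) (R₀ : ℝ) (p : ℕ) : 0 < clusterKp ψ N R₀ p := by
  unfold clusterKp
  have := zetaDensityConst_pos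
  positivity

/-- **T33 (far-offset cluster visibility with decay of order `p + 2`).**  As T30 with the far
surcharge `e^{2θ(c+1)}/Δ₀^{2p+2}` and the constant `K_{N,p}`. -/
theorem weilGroundEnergy_neg_of_farOffset_cluster_decay_eff (hψ : ContDiff ℝ ∞ ψ)
    (hsupp : tsupport ψ ⊆ Icc (-1) 1) (hψ0 : ∀ s, 0 ≤ ψ s) (N : ℕ) (R₀ : ℝ) (p : ℕ) :
    ∀ (η θ γ₀ c R δ Δ₀ : ℝ) (S' : Finset ℂ), 0 < η → η < 1 / 2 → θ < 1 / 2 → γ₀ ≠ 0 → 0 ≤ c →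
      1 ≤ R → Real.exp (c + 1) ≤ R ^ 2 → 0 < δ → δ ≤ 1 → 1 ≤ Δ₀ →
      riemannZeta (1 / 2 + η + γ₀ * I) = 0 → S'.card ≤ N →
      (∀ ρ ∈ S', ‖ρ - (1 / 2 + γ₀ * I)‖ ≤ R₀ ∧ δ ≤ ‖ρ - (1 / 2 + η + γ₀ * I)‖ ∧
          δ ≤ ‖ρ - (1 / 2 - η + γ₀ * I)‖) →
      (∀ ρ : ℂ, riemannZeta ρ = 0 → 0 ≤ ρ.re → ρ.re ≤ 1 → |ρ.im - γ₀| < R → ρ.re ≠ 1 / 2 →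
          ρ = 1 / 2 + η + γ₀ * I ∨ ρ = 1 / 2 - η + γ₀ * I ∨ ρ ∈ S' ∨
            (|ρ.re - 1 / 2| ≤ θ ∧ Δ₀ ≤ |ρ.im - γ₀|)) →
      bumpLaplace ψ (-η) ≤ Real.exp (η * c) * bumpLaplace ψ η →
      (clusterKp ψ N R₀ p * (1 + Real.exp (θ * (c + 1)) ^ 2 / Δ₀ ^ (2 * p + 2))
          * Real.log (|γ₀| + 2) <
          η ^ 4 * δ ^ (4 * N) *
            (Real.exp (η * c) * bumpLaplace ψ η - bumpLaplace ψ (-η)) ^ 2) →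
      weilGroundEnergy (c + 1) < 0 := by
  intro η θ γ₀ c R δ Δ₀ S' hη hη2 hθ2 hγ hc hR hRa hδ hδ1 hΔ hζ hcard hclus hloc hgainpos hwin
  unfold clusterKp at hwin
  have hT := weilGroundEnergy_neg_of_local_oddTest_cluster_far
  set A₁ : ℝ := zetaDensityConst
  have hA₁ : 0 < A₁ := zetaDensityConst_pos
  set Q : ℝ := (1 + R₀ ^ 2) ^ N * bumpNormSum ψ (2 * N + 4 + p) with hQ_def
  have hQ0 : 0 ≤ Q := by have := bumpNormSum_nonneg ψ (2 * N + 4 + p); positivity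
  set X : ℝ := Real.exp (θ * (c + 1)) ^ 2 / Δ₀ ^ (2 * p + 2) with hX_def
  have hΔ0 : 0 < Δ₀ := by linarith
  have hX0 : 0 ≤ X := by positivity
  set g : ℝ := Real.exp (η * c) * bumpLaplace ψ η - bumpLaplace ψ (-η) with hg_def
  have hlog : 0 < Real.log (|γ₀| + 2) := Real.log_pos (by linarith [abs_nonneg γ₀])
  have hXL : 0 ≤ X * Real.log (|γ₀| + 2) := mul_nonneg hX0 hlog.le
  have hAXL : 0 ≤ A₁ * Q ^ 2 * X * Real.log (|γ₀| + 2) := by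
    have := hA₁.le; positivity
  have hg0 : 0 ≤ g := sub_nonneg.mpr hgainpos
  have hgpos : 0 < g := by
    rcases hg0.lt_or_eq with h | h
    · exact h
    · exfalso
      rw [← h] at hwin
      have : 0 < (16 * A₁ * Q ^ 2 + 1) * (1 + X) * Real.log (|γ₀| + 2) := by positivity
      norm_num at hwin
      linarith
  -- the cluster test and the far set
  obtain ⟨k, hk, hkodd, hks, hpos, hnorm, hG, hvan⟩ :=
    exists_clusterTest_gen hψ hsupp hψ0 N R₀ p (γ₀ := γ₀) (S' := S') hη hc hδ hδ1 hcard hclus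
      hgpos
  obtain ⟨Sf, hSf_mem, hSf_all⟩ := exists_far_finset θ γ₀ R Δ₀ hθ2
  have hSf1 : ∀ ρ ∈ Sf, ρ ≠ 1 := by
    intro ρ hρ h1
    have hz := (hSf_mem ρ hρ).1
    rw [h1] at hz
    exact riemannZeta_one_ne_zero hz
  have hloc4 : ∀ ρ : ℂ, riemannZeta ρ = 0 → 0 ≤ ρ.re → ρ.re ≤ 1 → |ρ.im - γ₀| < R →
      ρ.re ≠ 1 / 2 → ρ = 1 / 2 + η + γ₀ * I ∨ ρ = 1 / 2 - η + γ₀ * I ∨ ρ ∈ S' ∨ ρ ∈ Sf := by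
    intro ρ hz h0 h1 hnear hre
    rcases hloc ρ hz h0 h1 hnear hre with h | h | h | ⟨hoff, hfarρ⟩
    · exact Or.inl h
    · exact Or.inr (Or.inl h)
    · exact Or.inr (Or.inr (Or.inl h))
    · exact Or.inr (Or.inr (Or.inr (hSf_all ρ hz hoff hfarρ hnear)))
  -- the on-line majorant (as in T25)
  have hk1 : ∫ t, ‖k t‖ ≤ 2 * Q := by simpa using hnorm 0 (by omega)
  have hk2 : ∫ t, ‖deriv k t‖ ≤ 2 * Q := by simpa using hnorm 1 (by omega)
  have hk3 : ∫ t, ‖iteratedDeriv 2 k t‖ ≤ 2 * Q := hnorm 2 (by omega)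
  have hkp : ∫ t, ‖iteratedDeriv (p + 2) k t‖ ≤ 2 * Q := hnorm (p + 2) le_rfl
  have hMloc : ((∫ t, ‖k t‖) ^ 2 + (∫ t, ‖deriv k t‖) ^ 2)
      + 2 * Real.exp (c + 1) * (∫ t, ‖iteratedDeriv 2 k t‖) ^ 2 / R ^ (2 * 1)
        ≤ 4 * (Q ^ 2 + Q ^ 2 + 2 * Q ^ 2) :=
    local_majorant_arith (integral_nonneg fun _ ↦ norm_nonneg _)
      (integral_nonneg fun _ ↦ norm_nonneg _) (integral_nonneg fun _ ↦ norm_nonneg _) hk1 hk2 hk3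
      (Real.exp_pos _) (by simpa using hRa)
  have h1 : 2 * A₁ * (((∫ t, ‖k t‖) ^ 2 + (∫ t, ‖deriv k t‖) ^ 2)
      + 2 * Real.exp (c + 1) * (∫ t, ‖iteratedDeriv 2 k t‖) ^ 2 / R ^ (2 * 1))
        * Real.log (|γ₀| + 2)
      ≤ 2 * A₁ * (4 * (Q ^ 2 + Q ^ 2 + 2 * Q ^ 2)) * Real.log (|γ₀| + 2) :=
    mul_le_mul_of_nonneg_right (mul_le_mul_of_nonneg_left hMloc (by positivity)) hlog.le
  -- the far terms (T28a with decay order `p + 2`)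
  have hF1 := sum_offline_far_le hk (by linarith : (0 : ℝ) ≤ c + 1) hks hθ2 hΔ
    (p := p + 2) (by omega) Sf hSf_mem
  have hBf : 2 * A₁ * (2 * (Real.exp (θ * (c + 1)) * ∫ t, ‖iteratedDeriv (p + 2) k t‖) ^ 2
      / Δ₀ ^ (2 * (p + 2) - 2)) * Real.log (|γ₀| + 2) ≤
      16 * (A₁ * Q ^ 2 * X * Real.log (|γ₀| + 2)) := by
    have h22 : Δ₀ ^ (2 * (p + 2) - 2) = Δ₀ ^ (2 * p + 2) := by
      rw [show 2 * (p + 2) - 2 = 2 * p + 2 by omega]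
    rw [h22]
    have hEN : (Real.exp (θ * (c + 1)) * ∫ t, ‖iteratedDeriv (p + 2) k t‖) ^ 2 ≤
        (Real.exp (θ * (c + 1)) * (2 * Q)) ^ 2 :=
      pow_le_pow_left₀ (by positivity) (mul_le_mul_of_nonneg_left hkp (Real.exp_pos _).le) 2
    have h3 : 2 * (Real.exp (θ * (c + 1)) * ∫ t, ‖iteratedDeriv (p + 2) k t‖) ^ 2
        / Δ₀ ^ (2 * p + 2) ≤
        2 * (Real.exp (θ * (c + 1)) * (2 * Q)) ^ 2 / Δ₀ ^ (2 * p + 2) :=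
      div_le_div_of_nonneg_right (by linarith) (by positivity)
    have h4 := mul_le_mul_of_nonneg_right (mul_le_mul_of_nonneg_left h3
      (by positivity : (0 : ℝ) ≤ 2 * A₁)) hlog.le
    refine h4.trans_eq ?_
    rw [hX_def]
    ring
  -- the zero has multiplicity `≥ 1`
  have hne1 : (1 / 2 + η + γ₀ * I : ℂ) ≠ 1 := by
    intro h
    apply hγ
    have := congrArg Complex.im h
    simpa using this
  have hm1 : (1 : ℝ) ≤ (riemannZetaZeroOrder (1 / 2 + η + γ₀ * I) : ℝ) := by
    have := (riemannZetaZeroOrder_pos_iff hne1).mpr hζ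
    have h1m : (1 : ℤ) ≤ riemannZetaZeroOrder (1 / 2 + η + γ₀ * I) := by omega
    exact_mod_cast h1m
  have hmP := mul_le_mul_of_nonneg_right hm1 (sq_nonneg ‖∫ t, k t * cexp ((η : ℂ) * t)‖)
  have h2 : 2 * A₁ * (4 * (Q ^ 2 + Q ^ 2 + 2 * Q ^ 2)) * Real.log (|γ₀| + 2)
      + 2 * A₁ * (2 * (Real.exp (θ * (c + 1)) * ∫ t, ‖iteratedDeriv (p + 2) k t‖) ^ 2
          / Δ₀ ^ (2 * (p + 2) - 2)) * Real.log (|γ₀| + 2) <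
      2 * ((riemannZetaZeroOrder (1 / 2 + η + γ₀ * I) : ℝ)
        * ‖∫ t, k t * cexp ((η : ℂ) * t)‖ ^ 2) := by
    linarith [hwin, hG, hmP, hlog, hBf, hXL, hAXL]
  have key := hT k (c + 1) η γ₀ R _ 1 S' Sf hk hkodd (by linarith) hR hks hpos hζ
    (abs_lt.mpr ⟨by linarith, hη2⟩) hη.ne' hγ hvan hSf1 hF1 hloc4
  exact key (by linarith [h1, h2])


/-! ## T34: window and exclusion forms -/

/-- The window offset with the constant `K_{N,p}`:
`max(η⁻¹ log(2Φ(−η)/Φ(η) + 1), (2η)⁻¹ log(4 (2K_{N,p}/δ^{4N})/(η⁴ Φ(η)²) + 1))`. -/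
noncomputable def clusterFarC0p (ψ : ℝ → ℝ) (N : ℕ) (R₀ : ℝ) (p : ℕ) (δ η : ℝ) : ℝ :=
  max (Real.log (2 * bumpLaplace ψ (-η) / bumpLaplace ψ η + 1) / η)
    (Real.log (4 * (2 * clusterKp ψ N R₀ p / δ ^ (4 * N)) / (η ^ 4 * bumpLaplace ψ η ^ 2) + 1)
      / (2 * η))

/-- **T34 (window form, decay of order `p + 2`).**  As T31 with `K_{N,p}` and the near zone
`Δ₀^{p+1} ≥ e^{θ(c+1)}`. -/
theorem weilGroundEnergy_neg_of_farOffset_cluster_decay_window_eff (hψ : ContDiff ℝ ∞ ψ)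
    (hsupp : tsupport ψ ⊆ Icc (-1) 1) (hψ0 : ∀ s, 0 ≤ ψ s) {η : ℝ} (hη : 0 < η)
    (hη2 : η < 1 / 2) (hΦ : 0 < bumpLaplace ψ η) (N : ℕ) (R₀ : ℝ) (p : ℕ) {δ : ℝ} (hδ : 0 < δ)
    (hδ1 : δ ≤ 1) {θ : ℝ} (hθ2 : θ < 1 / 2) :
    ∀ (γ₀ c R Δ₀ : ℝ) (S' : Finset ℂ), 1 ≤ |γ₀| →
      clusterFarC0p ψ N R₀ p δ η + Real.log (Real.log (|γ₀| + 2)) / (2 * η) ≤ c → 1 ≤ R →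
      Real.exp (c + 1) ≤ R ^ 2 → Real.exp (θ * (c + 1)) ≤ Δ₀ ^ (p + 1) → 1 ≤ Δ₀ →
      riemannZeta (1 / 2 + η + γ₀ * I) = 0 → S'.card ≤ N →
      (∀ ρ ∈ S', ‖ρ - (1 / 2 + γ₀ * I)‖ ≤ R₀ ∧ δ ≤ ‖ρ - (1 / 2 + η + γ₀ * I)‖ ∧
          δ ≤ ‖ρ - (1 / 2 - η + γ₀ * I)‖) →
      (∀ ρ : ℂ, riemannZeta ρ = 0 → 0 ≤ ρ.re → ρ.re ≤ 1 → |ρ.im - γ₀| < R → ρ.re ≠ 1 / 2 →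
          ρ = 1 / 2 + η + γ₀ * I ∨ ρ = 1 / 2 - η + γ₀ * I ∨ ρ ∈ S' ∨
            (|ρ.re - 1 / 2| ≤ θ ∧ Δ₀ ≤ |ρ.im - γ₀|)) →
      weilGroundEnergy (c + 1) < 0 := by
  intro γ₀ c R Δ₀ S' hγ hc hR hRa hΔ hΔ1 hζ hcard hclus hloc
  unfold clusterFarC0p at hc
  have hδN : 0 < δ ^ (4 * N) := by positivity
  have hK := clusterKp_pos ψ N R₀ p
  have hKδ : 0 < 2 * clusterKp ψ N R₀ p / δ ^ (4 * N) := by positivity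
  obtain ⟨hc0, hdom, hwin⟩ :=
    doubleLog_window_arith hKδ hΦ (bumpLaplace_nonneg hψ0 (-η)) hη hγ hc
  have hγ0 : γ₀ ≠ 0 := by intro h; rw [h, abs_zero] at hγ; linarith
  have hΔ0 : 0 < Δ₀ := by linarith
  have hX : Real.exp (θ * (c + 1)) ^ 2 / Δ₀ ^ (2 * p + 2) ≤ 1 := by
    rw [div_le_one (by positivity), show 2 * p + 2 = (p + 1) * 2 by ring, pow_mul]
    exact pow_le_pow_left₀ (Real.exp_pos _).le hΔ 2
  have hlog : 0 < Real.log (|γ₀| + 2) := Real.log_pos (by linarith [abs_nonneg γ₀])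
  have hwin' : clusterKp ψ N R₀ p * (1 + Real.exp (θ * (c + 1)) ^ 2 / Δ₀ ^ (2 * p + 2))
      * Real.log (|γ₀| + 2) <
      η ^ 4 * δ ^ (4 * N) *
        (Real.exp (η * c) * bumpLaplace ψ η - bumpLaplace ψ (-η)) ^ 2 := by
    have h := mul_lt_mul_of_pos_left hwin hδN
    have hδne : δ ^ (4 * N) ≠ 0 := hδN.ne'
    have e : δ ^ (4 * N) * (2 * clusterKp ψ N R₀ p / δ ^ (4 * N) * Real.log (|γ₀| + 2)) =
        2 * clusterKp ψ N R₀ p * Real.log (|γ₀| + 2) := by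
      field_simp
    rw [e] at h
    have hKL : 0 ≤ clusterKp ψ N R₀ p * Real.log (|γ₀| + 2) := by positivity
    calc clusterKp ψ N R₀ p * (1 + Real.exp (θ * (c + 1)) ^ 2 / Δ₀ ^ (2 * p + 2))
          * Real.log (|γ₀| + 2)
        = (1 + Real.exp (θ * (c + 1)) ^ 2 / Δ₀ ^ (2 * p + 2))
            * (clusterKp ψ N R₀ p * Real.log (|γ₀| + 2)) := by ring
      _ ≤ 2 * (clusterKp ψ N R₀ p * Real.log (|γ₀| + 2)) :=
          mul_le_mul_of_nonneg_right (by linarith) hKL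
      _ = 2 * clusterKp ψ N R₀ p * Real.log (|γ₀| + 2) := by ring
      _ < δ ^ (4 * N) * (η ^ 4 *
            (Real.exp (η * c) * bumpLaplace ψ η - bumpLaplace ψ (-η)) ^ 2) := h
      _ = η ^ 4 * δ ^ (4 * N) *
            (Real.exp (η * c) * bumpLaplace ψ η - bumpLaplace ψ (-η)) ^ 2 := by ring
  exact weilGroundEnergy_neg_of_farOffset_cluster_decay_eff hψ hsupp hψ0 N R₀ p η θ γ₀ c R δ Δ₀ S'
    hη hη2 hθ2 hγ0 hc0 hR hRa hδ hδ1 hΔ1 hζ hcard hclus hloc hdom hwin'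

/-- **T34″ (exclusion form, no far hypothesis, decay of order `p + 2`).**  With
`Θ = windowMaxOffset γ₀ R < ½`: for `ψ ≥ 0` smooth on `[−1, 1]`, `0 < η < ½`, `Φ(η) > 0`,
`0 < δ ≤ 1`, Weil positivity at the window `c + 1` (`c ≥ clusterFarC0p + log log(|γ₀|+2)/(2η)`,
`e^{c+1} ≤ R²`) and the near hypothesis in the zone `|Im ρ − γ₀| < Δ₀`,
`Δ₀ ≥ max(1, e^{Θ(c+1)/(p+1)})` — every off-line zero there is `½ ± η + iγ₀` or a member of the
bounded separated cluster `S'` — exclude the zero `½ + η + iγ₀`. -/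
theorem riemannZeta_ne_zero_of_nearCluster_decay_of_weilGroundEnergy_nonneg_eff
    (hψ : ContDiff ℝ ∞ ψ) (hsupp : tsupport ψ ⊆ Icc (-1) 1) (hψ0 : ∀ s, 0 ≤ ψ s) {η : ℝ}
    (hη : 0 < η) (hη2 : η < 1 / 2) (hΦ : 0 < bumpLaplace ψ η) (N : ℕ) (R₀ : ℝ) (p : ℕ) {δ : ℝ}
    (hδ : 0 < δ) (hδ1 : δ ≤ 1) :
    ∀ (γ₀ c R Δ₀ : ℝ) (S' : Finset ℂ), 1 ≤ |γ₀| →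
      clusterFarC0p ψ N R₀ p δ η + Real.log (Real.log (|γ₀| + 2)) / (2 * η) ≤ c → 1 ≤ R →
      Real.exp (c + 1) ≤ R ^ 2 → Real.exp (windowMaxOffset γ₀ R * (c + 1)) ≤ Δ₀ ^ (p + 1) →
      1 ≤ Δ₀ → S'.card ≤ N →
      (∀ ρ ∈ S', ‖ρ - (1 / 2 + γ₀ * I)‖ ≤ R₀ ∧ δ ≤ ‖ρ - (1 / 2 + η + γ₀ * I)‖ ∧
          δ ≤ ‖ρ - (1 / 2 - η + γ₀ * I)‖) →
      (∀ ρ : ℂ, riemannZeta ρ = 0 → 0 ≤ ρ.re → ρ.re ≤ 1 → |ρ.im - γ₀| < Δ₀ → ρ.re ≠ 1 / 2 →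
          ρ = 1 / 2 + η + γ₀ * I ∨ ρ = 1 / 2 - η + γ₀ * I ∨ ρ ∈ S') →
      0 ≤ weilGroundEnergy (c + 1) →
      riemannZeta (1 / 2 + η + γ₀ * I) ≠ 0 := by
  intro γ₀ c R Δ₀ S' hγ hc hR hRa hΔ hΔ1 hcard hclus hnear hE hζ
  obtain ⟨-, hθ2, hoff⟩ := windowMaxOffset_spec γ₀ R
  have hloc : ∀ ρ : ℂ, riemannZeta ρ = 0 → 0 ≤ ρ.re → ρ.re ≤ 1 → |ρ.im - γ₀| < R →
      ρ.re ≠ 1 / 2 → ρ = 1 / 2 + η + γ₀ * I ∨ ρ = 1 / 2 - η + γ₀ * I ∨ ρ ∈ S' ∨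
        (|ρ.re - 1 / 2| ≤ windowMaxOffset γ₀ R ∧ Δ₀ ≤ |ρ.im - γ₀|) := by
    intro ρ hz h0 h1 hRρ hre
    by_cases hn : |ρ.im - γ₀| < Δ₀
    · rcases hnear ρ hz h0 h1 hn hre with h | h | h
      · exact Or.inl h
      · exact Or.inr (Or.inl h)
      · exact Or.inr (Or.inr (Or.inl h))
    · exact Or.inr (Or.inr (Or.inr ⟨hoff ρ hz h0 h1 hRρ, not_lt.mp hn⟩))
  have := weilGroundEnergy_neg_of_farOffset_cluster_decay_window_eff hψ hsupp hψ0 hη hη2 hΦ N R₀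
    p hδ hδ1 hθ2 γ₀ c R Δ₀ S' hγ hc hR hRa hΔ hΔ1 hζ hcard hclus hloc
  linarith

/-- The near zone of T34″ against the window: `e^{Θ(c+1)/(p+1)} ≤ R^{2Θ/(p+1)} < R`; stated as
`e^{Θ(c+1)} < R^{p+1}`, so `Δ₀ := R` (or anything down to `e^{Θ(c+1)/(p+1)}`) is admissible. -/
theorem exp_windowMaxOffset_mul_lt_pow (γ₀ : ℝ) {c R : ℝ} (hR : 1 < R)
    (hRa : Real.exp (c + 1) ≤ R ^ 2) (p : ℕ) :
    Real.exp (windowMaxOffset γ₀ R * (c + 1)) < R ^ (p + 1) := by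
  refine (exp_windowMaxOffset_mul_lt γ₀ hR hRa).trans_le ?_
  exact (pow_one R).symm.le.trans (pow_le_pow_right₀ hR.le (by omega))

end Summit.RiemannHypothesis.RiemannHypothesis.Theorems
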